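import Literature.NumberTheory.EllipticCurves.Kato2004.LayerCharacterCuspFactorProofs
import Literature.NumberTheory.EllipticCurves.CyclotomicZpExtensionLayerTorsionProofs
import Literature.NumberTheory.EllipticCurves.KatoTwistedFinitenessEulerFactorsProofs
import Mathlib.NumberTheory.Padics.RingHoms
import HarnessLib

set_option autoImplicit false

/-!
# AUG engine, step 13: FAITHFUL LAYER CHARACTERS — `χ̄(χ_cyc γ)` is a primitive `p^k`-th root of unity for a layer
# character `χ` mod `p^{k+1}` and a topological generator `γ`; lifts of layer characters to higher levels
# (seat `bsd-cm-prr-ty1` g15, cell `bsd-cm`; theorems only: no definition, no named fact, no instance, no `sorry`)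

Part 55 of the seat's kernel cut of stub 3 of the Kato–Perrin-Riou skeletons v4 (cruxes stmt-BirchSwinnertonDyer-19945 /
-19223).  The ENDGAME for the display AUG (HOME `bsd-cm-prr-ty1/STUB3-CUT.md` §6 addenda 7–8) evaluates the identities (★χ) of E35
at ONE faithful character of every layer `Γ_k = Gal(ℚ_k/ℚ)`, read at an arbitrary higher level `n ≥ k`.  With the tree's LAYER
CHARACTERS (`Kato2004/LayerCharacterCuspFactorProofs`: Dirichlet characters mod `M = p^{k+1}` with kernel exactly
`Δ = {b : b^{p−1} = 1}`, `exists_layerCharacter`, `isPrimitive`) THIS FILE proves: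
* §1 `mem_layerSubgroup_of_modNCyclotomicCharacter_eq_one` — `ker χ^{(p^{k+1})} ≤ Gal(ℚ̄/ℚ_k)` (through the tree's
  `IsCyclotomic.rootsOfUnityFixer_le_layerSubgroup`); `prime_pow_dvd_of_pow_mem_layerSubgroup` — `γ^l ∈ Gal(ℚ̄/ℚ_k) ⇒ p^k ∣ l`
  for a topological generator `γ`;
* §2 ★ `isPrimitiveRoot_apply_modNCyclotomicCharacter` — for a layer character `χ` mod `p^{k+1}`: `χ(χ_cyc γ)` is a PRIMITIVE
  `p^k`-th root of unity (so the character points `ζ_χ − 1` of distinct layers are distinct);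
* §3 lifts `χ^{(L)} := changeLevel (p^{k+1} ∣ L) χ` to a level `L = p^{n+1}`, `n ≥ k`: they kill `Δ` (`changeLevel_apply_eq_one_of_pow_eq_one`),
  hence `Gal(ℚ̄/ℚ_n)` and `−1`; their values on `χ_cyc^{(L)}(σ)` and on integers prime to `p` are those of `χ`
  (`changeLevel_apply_modNCyclotomicCharacter`, via the tree's `CyclotomicZp.modNCyclotomicCharacter_eq_toZModPow` and Mathlib
  `PadicInt.zmod_cast_comp_toZModPow`; Mathlib `changeLevel_eq_cast_of_dvd'`); the twisted `L`-series is unchanged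
  (`twistedLSeries_changeLevel_prime_pow`, the tree's `twistedLSeries_changeLevel_eq_prod_mul` with no new prime);
* §4 ★ `exists_bound_continuation_one_ne_zero` — ROHRLICH IN THE ENDGAME'S SHAPE: given Rohrlich's finiteness (hypothesis `hR`, the
  exact statement of the tree theorem `PSRohrlichAtLevel.rohrlich_primePow_of_isNewformOf`, a `Summits/…/Theorems` file fed by the
  consumer), there is `B` such that for every `k ≥ B`, every layer character `χ` mod `p^{k+1}`, every lift to `L = p^{n+1}` and every
  entire continuation `L₀` of its twisted `L`-series: `L₀(1) ≠ 0`.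
HONEST LABEL: character theory and bookkeeping; no stub closed; nothing asserted on 19945 / 19223; no summit statement is proved;
BSD is not proved for any curve.
References: [Washington1997] §13.1 (the layers `ℚ_n ⊂ ℚ(ζ_{p^{n+1}})`, `Δ`), Ch. 3; [Kato2004Asterisque] §13.9 (p. 230), Thm. 12.5 (1)
and proof (pp. 221–222: "`L(f,χ,1) ≠ 0` for almost all characters `χ` of `Gal(ℚ(ζ_{p^∞})/ℚ)` [Ro1]"); [RohrlichInventiones1984] Theorem (p. 409).
-/

noncomputable section

open scoped BigOperators
open Field
open Literature.NumberTheory.GaloisRepresentations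
open Literature.NumberTheory.EllipticCurves Literature.NumberTheory.EllipticCurves.ModularForms
open Literature.NumberTheory.EllipticCurves.Kato2004

namespace Summit.BirchSwinnertonDyer.Rank1Residual.Additive.PerrinRiouUnit

variable {p : ℕ} [hp : Fact p.Prime] {K : ZpExtension ℚ p} {γ : absoluteGaloisGroup ℚ}

/-! ## §1 The kernel of `χ_cyc^{(p^{k+1})}` and the powers of `γ` in the layer subgroups -/

/-- **`ker χ_cyc^{(p^{k+1})} ≤ Gal(ℚ̄/ℚ_k)`**: an automorphism acting trivially on `μ_{p^{k+1}}` fixes `ℚ_k ⊂ ℚ(ζ_{p^{k+1}})`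
(every cyclotomic `κ`, `p` odd). [cite: Washington1997, §13.1] -/
theorem mem_layerSubgroup_of_modNCyclotomicCharacter_eq_one (hK : K.IsCyclotomic) (hp2 : p ≠ 2) (k : ℕ) {M : ℕ} [NeZero M]
    (hM : M = p ^ (k + 1)) {σ : absoluteGaloisGroup ℚ} (hσ : modNCyclotomicCharacter ℚ M σ = 1) :
    σ ∈ K.layerSubgroup k := by
  subst hM
  refine hK.rootsOfUnityFixer_le_layerSubgroup hp2 k (mem_rootsOfUnityFixer_iff.mpr fun t ht => ?_)
  have h1 : 1 < p ^ (k + 1) := Nat.one_lt_pow (Nat.succ_ne_zero k) hp.out.one_lt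
  rw [modNCyclotomicCharacter_spec ℚ (p ^ (k + 1)) σ t ht, hσ, Units.val_one, ZMod.val_one_eq_one_mod,
    Nat.mod_eq_of_lt h1, pow_one]

/-- **`γ^l ∈ Gal(ℚ̄/ℚ_k) ⇒ p^k ∣ l`** for a topological generator `γ` (`κ γ = 1`, so `κ(γ^l) = l`). [cite: Washington1997, §13.1] -/
theorem prime_pow_dvd_of_pow_mem_layerSubgroup (hγ : K.IsTopGenerator γ) {k l : ℕ} (h : γ ^ l ∈ K.layerSubgroup k) :
    p ^ k ∣ l := by
  have hγ' : K γ = Multiplicative.ofAdd 1 := hγ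
  rw [ZpExtension.mem_layerSubgroup, map_pow, hγ', ← ofAdd_nsmul, toAdd_ofAdd, nsmul_eq_mul, mul_one] at h
  have hnorm : ‖((l : ℤ) : ℤ_[p])‖ ≤ (p : ℝ) ^ (-k : ℤ) := by
    rw [Int.cast_natCast, PadicInt.norm_le_pow_iff_mem_span_pow]
    exact Ideal.mem_span_singleton.mpr h
  have hdvd : (p ^ k : ℤ) ∣ (l : ℤ) := PadicInt.norm_int_le_pow_iff_dvd.mp hnorm
  exact_mod_cast hdvd

/-! ## §2 A layer character takes a primitive `p^k`-th root of unity at `χ_cyc γ` -/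

/-- `p^k` and `p − 1` are coprime. [folklore] -/
theorem coprime_prime_pow_sub_one (k : ℕ) : (p ^ k).Coprime (p - 1) := by
  refine Nat.Coprime.pow_left k ((Nat.Prime.coprime_iff_not_dvd hp.out).mpr fun h => ?_)
  have h2 := hp.out.two_le
  have := Nat.le_of_dvd (by omega) h
  omega

/-- ★ **For a layer character `χ` mod `p^{k+1}` (kernel exactly `Δ`) and a topological generator `γ` of the cyclotomic tower,
`χ(χ_cyc γ)` is a PRIMITIVE `p^k`-th root of unity**: `χ(χ_cyc γ)^{p^k} = 1` (values of layer characters), and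
`χ(χ_cyc γ)^l = 1 ⇒ χ_cyc(γ)^{l(p−1)} = 1 ⇒ γ^{l(p−1)} ∈ Gal(ℚ̄/ℚ_k) ⇒ p^k ∣ l(p−1) ⇒ p^k ∣ l`.  (`γ` maps to a generator of
`Gal(ℚ_k/ℚ) ≅ (ℤ/p^{k+1})ˣ/Δ ≅ ℤ/p^k`, on which `χ` is faithful.) [cite: Washington1997, §13.1] -/
theorem isPrimitiveRoot_apply_modNCyclotomicCharacter (hK : K.IsCyclotomic) (hp2 : p ≠ 2) (hγ : K.IsTopGenerator γ)
    (k : ℕ) {M : ℕ} [NeZero M] (hM : M = p ^ (k + 1)) {χ : DirichletCharacter ℂ M}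
    (hker : ∀ b : (ZMod M)ˣ, χ b = 1 ↔ b ^ (p - 1) = 1) :
    IsPrimitiveRoot (χ ((modNCyclotomicCharacter ℚ M γ : (ZMod M)ˣ) : ZMod M)) (p ^ k) := by
  refine ⟨LayerCharacter.apply_pow_eq_one hM hker _, fun l hl => ?_⟩
  -- `χ((χ_cyc γ)^l) = 1`, so `(χ_cyc γ)^l ∈ Δ`
  have h1 : (modNCyclotomicCharacter ℚ M γ ^ l) ^ (p - 1) = 1 :=
    (hker _).mp (by rw [Units.val_pow_eq_pow_val, map_pow]; exact hl)
  have h2 : modNCyclotomicCharacter ℚ M (γ ^ (l * (p - 1))) = 1 := by rw [map_pow, pow_mul, h1]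
  have h3 := prime_pow_dvd_of_pow_mem_layerSubgroup hγ
    (mem_layerSubgroup_of_modNCyclotomicCharacter_eq_one hK hp2 k hM h2)
  exact (coprime_prime_pow_sub_one k).dvd_of_dvd_mul_right h3

/-- The same for the inverse character (also a layer character). [cite: Washington1997, §13.1] -/
theorem isPrimitiveRoot_inv_apply_modNCyclotomicCharacter (hK : K.IsCyclotomic) (hp2 : p ≠ 2) (hγ : K.IsTopGenerator γ)
    (k : ℕ) {M : ℕ} [NeZero M] (hM : M = p ^ (k + 1)) {χ : DirichletCharacter ℂ M}
    (hker : ∀ b : (ZMod M)ˣ, χ b = 1 ↔ b ^ (p - 1) = 1) :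
    IsPrimitiveRoot (χ⁻¹ ((modNCyclotomicCharacter ℚ M γ : (ZMod M)ˣ) : ZMod M)) (p ^ k) :=
  isPrimitiveRoot_apply_modNCyclotomicCharacter hK hp2 hγ k hM (LayerCharacter.inv hker)

/-! ## §3 Lifting a layer character mod `p^{k+1}` to a level `L = p^{n+1}`, `n ≥ k` -/

section Lift

variable {k : ℕ} {L : ℕ} [NeZero L]

omit hp [NeZero L] in
/-- **A lift of a character killing `Δ` kills `Δ`**: `b^{p−1} = 1` in `(ℤ/L)ˣ` ⇒ `χ^{(L)}(b) = χ(b mod p^{k+1}) = 1`.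
[cite: Washington1997, §13.1] -/
theorem changeLevel_apply_eq_one_of_pow_eq_one (hdvd : p ^ (k + 1) ∣ L) {χ : DirichletCharacter ℂ (p ^ (k + 1))}
    (hker : ∀ b : (ZMod (p ^ (k + 1)))ˣ, b ^ (p - 1) = 1 → χ b = 1) (b : (ZMod L)ˣ) (hb : b ^ (p - 1) = 1) :
    DirichletCharacter.changeLevel hdvd χ b = 1 := by
  have h := hker (ZMod.unitsMap hdvd b) (by rw [← map_pow, hb, map_one])
  rwa [DirichletCharacter.changeLevel_eq_cast_of_dvd χ hdvd, ← ZMod.unitsMap_val]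

omit [NeZero L] in
/-- A lift of a character killing `Δ` is even (`p` odd: `(−1)^{p−1} = 1`). [cite: Washington1997, §13.1] -/
theorem changeLevel_apply_neg_one (hp2 : p ≠ 2) (hdvd : p ^ (k + 1) ∣ L) {χ : DirichletCharacter ℂ (p ^ (k + 1))}
    (hker : ∀ b : (ZMod (p ^ (k + 1)))ˣ, b ^ (p - 1) = 1 → χ b = 1) :
    DirichletCharacter.changeLevel hdvd χ (-1) = 1 := by
  have h := changeLevel_apply_eq_one_of_pow_eq_one hdvd hker (-1) (by rw [(hp.out.even_sub_one hp2).neg_one_pow])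
  rwa [Units.val_neg, Units.val_one] at h

/-- A lift of a character killing `Δ` kills `χ_cyc^{(L)}(Gal(ℚ̄/ℚ_n))`, `L = p^{n+1}` (every cyclotomic `κ`, `p` odd) — the
hypothesis `hχ` of E31/E35. [cite: Washington1997, §13.1] -/
theorem changeLevel_apply_modNCyclotomicCharacter_eq_one_of_mem_layerSubgroup (hK : K.IsCyclotomic) (hp2 : p ≠ 2) {n : ℕ}
    (hL : L = p ^ (n + 1)) (hdvd : p ^ (k + 1) ∣ L) {χ : DirichletCharacter ℂ (p ^ (k + 1))}
    (hker : ∀ b : (ZMod (p ^ (k + 1)))ˣ, b ^ (p - 1) = 1 → χ b = 1) {σ : absoluteGaloisGroup ℚ}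
    (hσ : σ ∈ K.layerSubgroup n) :
    DirichletCharacter.changeLevel hdvd χ ((modNCyclotomicCharacter ℚ L σ : (ZMod L)ˣ) : ZMod L) = 1 :=
  hK.dirichletCharacter_apply_eq_one_of_mem_layerSubgroup hp2 n hL _
    (changeLevel_apply_eq_one_of_pow_eq_one hdvd hker) hσ

/-- **Reduction of the mod-`p^{n+1}` cyclotomic character is the mod-`p^{k+1}` one** (both are reductions of `χ_p`).
[cite: SerreAbelianLadic1968, Ch. I §1.2] -/
theorem cast_modNCyclotomicCharacter_prime_pow {n : ℕ} (hkn : k ≤ n) (σ : absoluteGaloisGroup ℚ) :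
    (ZMod.cast ((modNCyclotomicCharacter ℚ (p ^ (n + 1)) σ : (ZMod (p ^ (n + 1)))ˣ) : ZMod (p ^ (n + 1))) :
        ZMod (p ^ (k + 1))) =
      ((modNCyclotomicCharacter ℚ (p ^ (k + 1)) σ : (ZMod (p ^ (k + 1)))ˣ) : ZMod (p ^ (k + 1))) := by
  haveI : NeZero (p ^ (n + 1)) := ⟨pow_ne_zero _ hp.out.ne_zero⟩
  haveI : NeZero (p ^ (k + 1)) := ⟨pow_ne_zero _ hp.out.ne_zero⟩
  rw [CyclotomicZp.modNCyclotomicCharacter_eq_toZModPow p (n + 1) σ, CyclotomicZp.modNCyclotomicCharacter_eq_toZModPow p (k + 1) σ,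
    ← PadicInt.zmod_cast_comp_toZModPow (k + 1) (n + 1) (by omega), RingHom.comp_apply, ZMod.castHom_apply]

/-- **The lift agrees with `χ` on the cyclotomic characters**: `χ^{(L)}(χ_cyc^{(L)} σ) = χ(χ_cyc^{(p^{k+1})} σ)`, `L = p^{n+1}`,
`n ≥ k`. [cite: Washington1997, §13.1] -/
theorem changeLevel_apply_modNCyclotomicCharacter {n : ℕ} (hkn : k ≤ n) (hL : L = p ^ (n + 1)) (hdvd : p ^ (k + 1) ∣ L)
    (χ : DirichletCharacter ℂ (p ^ (k + 1))) (σ : absoluteGaloisGroup ℚ) :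
    DirichletCharacter.changeLevel hdvd χ ((modNCyclotomicCharacter ℚ L σ : (ZMod L)ˣ) : ZMod L) =
      χ ((modNCyclotomicCharacter ℚ (p ^ (k + 1)) σ : (ZMod (p ^ (k + 1)))ˣ) : ZMod (p ^ (k + 1))) := by
  subst hL
  rw [DirichletCharacter.changeLevel_eq_cast_of_dvd χ hdvd, cast_modNCyclotomicCharacter_prime_pow hkn]

omit hp in
/-- The lift agrees with `χ` at an integer prime to `p`. [folklore] -/
theorem changeLevel_apply_intCast {n : ℕ} (hL : L = p ^ (n + 1)) (hdvd : p ^ (k + 1) ∣ L)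
    (χ : DirichletCharacter ℂ (p ^ (k + 1))) {m : ℤ} (hm : IsCoprime m p) :
    DirichletCharacter.changeLevel hdvd χ (m : ZMod L) = χ (m : ZMod (p ^ (k + 1))) := by
  subst hL
  refine DirichletCharacter.changeLevel_eq_cast_of_dvd' χ hdvd ?_
  push_cast
  exact hm.pow_right

omit hp [NeZero L] in
/-- The inverse of the lift is the lift of the inverse. [folklore] -/
theorem changeLevel_inv (hdvd : p ^ (k + 1) ∣ L) (χ : DirichletCharacter ℂ (p ^ (k + 1))) :
    (DirichletCharacter.changeLevel hdvd χ)⁻¹ = DirichletCharacter.changeLevel hdvd χ⁻¹ :=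
  (map_inv (DirichletCharacter.changeLevel hdvd) χ).symm

/-- **The twisted `L`-series is unchanged by lifting from `p^{k+1}` to `p^{n+1}`** (no new prime enters the depletion; the tree's
`twistedLSeries_changeLevel_eq_prod_mul`). [cite: Kato2004Asterisque, §6.2 (p. 161)] -/
theorem twistedLSeries_changeLevel_prime_pow {N : ℕ} [NeZero N] {f : CuspForm (CongruenceSubgroup.Gamma0 N) 2} (hf : IsNewform0 f)
    {n : ℕ} (hL : L = p ^ (n + 1)) (hdvd : p ^ (k + 1) ∣ L) (χ : DirichletCharacter ℂ (p ^ (k + 1))) {s : ℂ}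
    (hs : 2 < s.re) : twistedLSeries f (DirichletCharacter.changeLevel hdvd χ) s = twistedLSeries f χ s := by
  rw [twistedLSeries_changeLevel_eq_prod_mul hf hdvd χ hs]
  have hempty : L.primeFactors.filter (fun q => ¬ q ∣ p ^ (k + 1)) = ∅ := by
    refine Finset.filter_eq_empty_iff.mpr fun q hq hndvd => hndvd ?_
    rw [hL, Nat.primeFactors_prime_pow (Nat.succ_ne_zero n) hp.out, Finset.mem_singleton] at hq
    rw [hq]
    exact dvd_pow_self p (Nat.succ_ne_zero k)
  rw [hempty, Finset.prod_empty, one_mul]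

end Lift

/-! ## §4 Rohrlich in the endgame's shape -/

/-- ★ **Beyond a bound `B`, every lift of every layer character has `L₀(1) ≠ 0` for every entire continuation `L₀` of its
twisted `L`-series**, GIVEN Rohrlich's finiteness `hR` for the newform `f` (the statement of the tree theorem
`PSRohrlichAtLevel.rohrlich_primePow_of_isNewformOf`, imported by the consumer): layer characters of level `p^{k+1}`, `k ≥ 1`, are
primitive (`LayerCharacter.isPrimitive`), the lift does not change the `L`-series (§3), and the exceptional conductors are bounded.
[cite: RohrlichInventiones1984, Theorem (p. 409)] [cite: Kato2004Asterisque, Thm. 12.5 (1) and proof (pp. 221–222)] -/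
theorem exists_bound_continuation_one_ne_zero {N : ℕ} [NeZero N] {f : CuspForm (CongruenceSubgroup.Gamma0 N) 2}
    (hf : IsNewform0 f)
    (hR : Set.Finite {χ : Σ m : ℕ, DirichletCharacter ℂ m |
        χ.1 ≠ 0 ∧ χ.1.primeFactors ⊆ {p} ∧ χ.2.IsPrimitive ∧
          ∃ L : ℂ → ℂ, Differentiable ℂ L ∧ (∀ s : ℂ, 2 < s.re → L s = twistedLSeries f χ.2 s) ∧ L 1 = 0}) :
    ∃ B : ℕ, ∀ k : ℕ, B ≤ k → ∀ {χ : DirichletCharacter ℂ (p ^ (k + 1))},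
      (∀ b : (ZMod (p ^ (k + 1)))ˣ, χ b = 1 ↔ b ^ (p - 1) = 1) →
      ∀ {L : ℕ} {n : ℕ}, L = p ^ (n + 1) → ∀ (hdvd : p ^ (k + 1) ∣ L) (L₀ : ℂ → ℂ), Differentiable ℂ L₀ →
        (∀ s : ℂ, 2 < s.re → L₀ s = twistedLSeries f (DirichletCharacter.changeLevel hdvd χ) s) → L₀ 1 ≠ 0 := by
  obtain ⟨B, hB⟩ := (hR.image Sigma.fst).bddAbove
  refine ⟨B + 1, fun k hk χ hker L n hL hdvd L₀ hL₀d hL₀s h0 => ?_⟩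
  haveI : NeZero (p ^ (k + 1)) := ⟨pow_ne_zero _ hp.out.ne_zero⟩
  haveI : NeZero L := ⟨by rw [hL]; exact pow_ne_zero _ hp.out.ne_zero⟩
  have hprim : χ.IsPrimitive := LayerCharacter.isPrimitive (by omega) rfl hker
  -- `L₀` continues the twisted series of the primitive `χ` itself
  have hL₀s' : ∀ s : ℂ, 2 < s.re → L₀ s = twistedLSeries f χ s := fun s hs => by
    rw [hL₀s s hs, twistedLSeries_changeLevel_prime_pow hf hL hdvd χ hs]
  have hle : p ^ (k + 1) ≤ B := by
    refine hB ⟨⟨p ^ (k + 1), χ⟩, ?_, rfl⟩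
    exact ⟨NeZero.ne _, by rw [Nat.primeFactors_prime_pow (Nat.succ_ne_zero k) hp.out], hprim, L₀, hL₀d, hL₀s', h0⟩
  have hlt : k + 1 < p ^ (k + 1) := Nat.lt_pow_self hp.out.one_lt
  omega

/-- **Layer characters exist at every level** (restated pointer: the tree's `LayerCharacter.exists_layerCharacter` at `M = p^{k+1}`).
[cite: Washington1997, §13.1] -/
theorem exists_layerCharacter_prime_pow (hp2 : p ≠ 2) (k : ℕ) :
    ∃ χ : DirichletCharacter ℂ (p ^ (k + 1)), ∀ b : (ZMod (p ^ (k + 1)))ˣ, χ b = 1 ↔ b ^ (p - 1) = 1 :=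
  haveI : NeZero (p ^ (k + 1)) := ⟨pow_ne_zero _ hp.out.ne_zero⟩
  LayerCharacter.exists_layerCharacter hp2 k rfl

end Summit.BirchSwinnertonDyer.Rank1Residual.Additive.PerrinRiouUnit

end
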